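import Summits.MatrixMultiplication.MatrixMultiplication.Theses.LevelGradedCohnUmans
import HarnessLib.Audit

/-!
# Line `garnir-annihilator` — crux `LevelGradedCohnUmans.SnLevelDesigns` (stmt-MatrixMultiplication-7613)

PLANNER GEN-2 VARIANT (planner-cruxplan-stmt-MatrixMultiplication-7613-garnir-annihilator-g2-0, 2026-08-16) — NOT the
registered skeleton. This file is the lead's reshape above with ONE proposed change for the lead's consideration:
S5 `EpsilonGlue`, S5g `HookGlue` and S6 `GarnirDesigns` are restated over `NearWall P` (sub-exponential slack
`e^{δ√k}` for every `δ > 0`, guard `3k ≤ n` = the regime of S5h (b)) instead of `∃ C … k³ ≤ n ∧ … ≤ k^C · V`.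
S1 S2 S3 S4 S5h and every proof are byte-identical to the registered skeleton; `SnLevelDesigns_of` is unchanged; the
registered forms of S5g/S6 imply these (so adopting later never invalidates landed work), and a proof of this S5g
proves the registered one. Two effects for the designer of S6: slack `e^{o(√k)}` instead of `k^{O(1)}`, and regime
`n ≥ 3k` instead of `n ≥ k³` (the relief asked for in `NegativeNotes-garnir-annihilator-drefute-r1.md`, remark (1)). Rationale (power-mean necessity vs Vershik–Kerov sufficiency) in the `NearWall`
docstring and in `Lines/garnir-annihilator.md` § "Gen-2 planner recommendation". To adopt: copy this file over
`Lines/garnir-annihilator.lean` and re-run `ledger skeleton check` (changes the registered signatures of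
`stub_hookGlue` and `stub_garnirDesigns` only).


LEAD RESHAPE (prover-line-stmt-MatrixMultiplication-7613-0, 2026-08-16): (i) S3 `BlockDescent` now asserts
`bruhatLE (p*σ) p ∧ posWeight p < posWeight (p*σ)` with the position weight `Φ(w) = Σ i·w(i)` instead of the
inversion count (one-swap computation instead of inversion combinatorics; the straightening induction below runs on
`n³ - Φ`); (ii) S5 `EpsilonGlue` is split into S5h `FirstRowHooks` (first-row hook peeling: `f^μ ≤ C(n,j)·D(j)` and
`levelDim n k ≥ e^{-2} C(n,k)² k!` for `3k ≤ n`) and S5g `HookGlue : FirstRowHooks → EpsilonGlue` (Vershik–Kerov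
analysis + rpow transfer). Seven registered stubs: S1 S2 S3 S4 S5h S5g S6; `SnLevelDesigns_of` unchanged in shape.

Skeleton (crux-plan, round 1; idea card `Cruxes/SnLevelDesigns/Ideas/garnir-annihilator.md`, triage
`TRIAGE-r1-{1,2,3}`: pass × 3 "as a two-sided TOOL … should ride with the RSS/KL line, annihilator side";
this file turns the tool into a CONCLUDING line whose distinctive half is the annihilator-side straightening).

CRUX (by name): `Summit.MatrixMultiplication.MatrixMultiplication.Theses.LevelGradedCohnUmans.SnLevelDesigns` —
`∀ ε > 0 ∃ n k X Y Z ⊆ 𝔖ₙ`, `k`-token separated (tests `g ↦ Σ_{p : [k] → [n]} c p (g ∘ p)`), with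
`Σ_{μ ⊢ n, μ₁ ≥ n-k} (f^μ)^{2+ε} < (|X||Y||Z|)^{(2+ε)/3}`.

THE LINE (annihilator side of the level-`k` algebra `A_k = ℂ𝔖ₙ / J_k^⊥`, `J_k^⊥ = T_k^⊥` the annihilator of
the `k`-token space). Card lever: `J_k^⊥` is the two-sided ideal generated by the Young antisymmetrizers
`ε_B = Π_i Σ_{σ ∈ Sym(B_i)} sgn(σ) σ` of block systems `B` of EXCESS `Σ_i (|B_i| - 1) ≥ k + 1` ("Garnir cosets").
A block system is rendered as a labelling `blk : Fin n → Fin n` (blocks = fibres; `numBlocks` = number of labels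
used; excess `= n - numBlocks`); its Young subgroup is the finset `blockStab blk = {σ | blk ∘ σ = blk}`.
* S1 `stub_garnirVanishing` — THE LEVER (size S–M): for every block labelling of excess `≥ k+1`, every token table
  `c` and all `a b ∈ 𝔖ₙ`, `Σ_{σ ∈ blockStab blk} sgn(σ) · f_c(a σ b) = 0` — i.e. `sgn · 1_{a·S_B·b} ∈ T_k^⊥`.
  Proof = the card's pigeonhole: a `k`-tuple `b ∘ p` misses two points of one block, right multiplication by their
  transposition preserves the fibre `{(aσb) ∘ p = r}` and flips the sign. Generalises `Disproof.sum_coset_sign_mul_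
  tokenFn` (cubes `(ℤ/2)^{k+1}`) and `Disproof.sum_sign_mul_tokenFn` (one block `[n]`) to every shape.
* S2 `stub_decreasingCover` (size M; Greene–Mirsky dual of Schensted): a permutation with NO increasing subsequence
  of length `n - k` (i.e. outside the Schensted shell `B_k = {lis ≥ n-k}`) is strictly decreasing on the blocks of
  some labelling with `≤ n-k-1` blocks (patience levels: `blk a =` length of the longest increasing subsequence
  ending at `a`), hence carries an ADMISSIBLE Garnir system (`Admissible`: excess `≥ k+1` and block-decreasing).
* S3 `stub_blockDescent` (size M): if `p` is decreasing on the blocks of `blk` then every proper rearrangement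
  `p σ`, `σ ∈ blockStab blk ∖ 1`, lies BELOW `p` in the (rank-matrix) Bruhat order and has fewer inversions
  (`p` places the largest values of each block earliest: a block-by-block count of the rank matrices; `p` is the
  longest element of its coset `p·S_B`).
  S1–S3 give GARNIR STRAIGHTENING, proved below from the stubs (`tokenFn_eq_zero_of_not_bruhatLE`): modulo `J_k^⊥`
  every `p ∉ B_k` is a signed sum of the other members of an admissible Garnir coset, all Bruhat-below `p`; by
  induction on inversions every `p` straightens onto shell elements Bruhat-below it — the `ShadowStraightening`
  that cards kl-schensted-certificate / lis-bruhat-shield take from Kazhdan–Lusztig cell theory (RSS 2009 + KL 1979),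
  here ELEMENTARY (no KL basis, no cells, no RSK), and with the observed sign/product structure of the coefficients
  (kl card: 87 % of straightening coefficients are ±1 — iterated signed coset relations produce exactly that).
* S4 `stub_shellInterpolation` (size L; Raghavan–Samuel–Subrahmanyam 2009 Thm 2 at `λ = (n-k,1^k)`, guard `k ≤ n`
  — triage r1-3's correction of the card's `stub_shell_interpolating`): every function on the Schensted shell is the
  restriction of a `k`-token function (the shell is independent in `A_k`; with S1–S3's spanning this is the count
  `#B_k = Σ_{μ₁ ≥ n-k} (f^μ)² = dim T_k`: Schensted 1961 + EFP 2011 Thm 7, `EllisFriedgutPilpel2011_thm7_holds`).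
  Numerically certain (three independent exact checks, n ≤ 8; kit j008490, j010256, j010362).
* S5 `stub_epsilonGlue` (size M; the merged poly-slack-transfer / classical-sandwich ε-bookkeeping, triage: "land as
  the shared support glue of the constructive line"): for ANY property `P` of level-`k` triples, a family with
  `D_k(n)^{3/2} ≤ k^C · |X||Y||Z|`, `n ≥ k³`, along `k → ∞` contains, for every `ε > 0`, a member satisfying the
  crux's budget inequality — Vershik–Kerov upper bound (`VershikKerov1985_maxCharDegree_holds`, PROVED in tree) +
  hook-length peeling `f_{(n-j,ν)} ≤ C(n,j) f_ν`. Uniform in `P`, so it is glue, not a restatement.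
* S6 `stub_garnirDesigns` — THE CLOSER (hardest; the line's Transfer `C⁺`, open): along `k → ∞` (`n ≥ k³`) there
  are triples `X, Y, Z ⊆ 𝔖ₙ` within `k^C` of the wall (`D_k^{3/2} ≤ k^C |X||Y||Z|`) that are GARNIR-CERTIFIED:
  `k ≤ n`, targets `x⁻¹z` in the shell, and for every target `t` every non-target quadruple product `p` lies in the
  inductive GARNIR-AVOIDANCE set `GarnirAvoid n k t` — generated by (shell) `p ∈ B_k, p ≠ t`; (incomparable)
  `t ≰_B p`; (step) ALL proper rearrangements `p σ`, `σ ∈ blockStab blk ∖ 1`, of `p` under SOME block labelling of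
  excess `≥ k+1` (any shape, decreasing or not — the designer's choice) avoid `t`. This contains the Bruhat-shadow
  certificate `ShadowTPP` of the KL line as the sub-case "shell ∪ incomparable" and is strictly more permissive
  (kl card's census: true straightening supports are ≈ half the Bruhat shadow), LA-free, and tolerant to poly(k)
  losses; it is still the crux's construction problem and carries all of its difficulty — honestly named, not hidden.
  TOY EVIDENCE (this seat, `compute/toy_garnir.py`, exact arithmetic; kit j010715, j010717, j010760, summaries on the
  item): writing `c_{p,t}` for the straightening coefficient of `p` on the shell element `t` (`= f_t(p)`), the
  certificates are SOUND (0 certified pairs with `c_{p,t} ≠ 0` at every depth) and their reach among the pairs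
  `(t, p ∉ B_k)` with `c_{p,t} = 0`, for trees of depth ≤ 0 (= Bruhat shadow) / 1 / 2 / 3 / 4 / 5, is
  `(4,1)`: 54/88/100 %; `(5,1)`: 55/70/90/99.6/99.8/99.8 % (closure reached: 2 of 1 100 zeros are pure cancellations);
  `(5,2)`: 60/84/99/100 %; `(6,1)`: 52/58/72/91/99.5/99.8 %; `(6,2)`: 66/74/87/97/99.3/99.7 %; `(6,3)`:
  63/80/94/99.1/99.8/99.9 % — the avoidance certificate all but DECIDES `c_{p,t} = 0`, the Bruhat shadow sees half.
  The same runs re-verify S1 (0 violations over all set partitions of excess ≥ k+1), S2/S3 (0 violations, 69 000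
  block rearrangements) and S4 (`rank = #B_k = dim T_k = 10, 17, 78, 26, 207, 588`).
The composition `SnLevelDesigns_of : S1 → S2 → S3 → S4 → S5 → S6 → SnLevelDesigns` is PROVED below:
S4 gives the dual functional `f_t` of a target (`= δ_t` on the shell); S1 kills `f_t` on every `step` node whose
children it kills; S1+S2+S3 kill it on `{p : t ≰_B p}` (induction on inversions); so `f_t` vanishes on
`GarnirAvoid n k t ∋` every non-target product and equals `1` at the target: the crux's separation clause verbatim
(`separated_of_certified`); S5 at `P := GarnirCertified` fed with S6 supplies `(n,k,X,Y,Z)` and the budget clause.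
Also proved here from S1 alone (the card's design-side KILL-TEST, necessary direction): if `Y ⊇ y₁·blockStab blk`
for one labelling of excess `≥ k+1` (e.g. `Y` contains a coset of `Sym` of `k+2` points, or of `k+1` disjoint
transpositions) and `X, Z ≠ ∅`, then `(X,Y,Z)` is NOT `k`-token separated (`not_separated_of_coset_subset`).

DISPROOF USED (`Cruxes/SnLevelDesigns/Disproof.lean`, cdisprove v3 2026-08-16T02:07Z, VERDICT: NO KILL; no
`_false_without_` theorem exists for this crux; landed Negative lemmas `Theorems/SnLevelDesigns/Negative/
{CoveringWall,DimensionWalls,DeadCorners}.lean` are consequences of separation and are honoured automatically since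
the line CONCLUDES the separation clause verbatim and never weakens it):
* LOAD-BEARING clauses `exists_budget_lt_volPow` (separation) / `at_le_version_trivial` (strict `<`): honoured —
  `separated_of_certified` produces `Sep` itself; S5/S6 keep the strict inequality of the crux.
* `not_at_level_zero`, `not_at_level_one` (levels 0, 1 dead), graded Neumann count `volume_le_of_cubic_budget`
  (every fixed level dies as `ε → 0`, `k(ε) ≳ 6/ε`): honoured by the SHAPE of S6 (`∀ k₀ ∃ k ≥ k₀`, `n ≥ k³`): the
  line never bets on a fixed level; the sibling refutation `LevelGradedCohnUmansLevelTwoBeatsCubes_refuted`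
  (negatives index) is a fixed-level statement and is not restated.
* COSET OBSTRUCTION `exists_coset_point_not_mem_quot` / `sum_coset_sign_mul_tokenFn`: S1 is its generalisation to all
  block shapes; the kill-test below is its design-side form; and `GarnirAvoid` can never certify a product set
  containing a full Garnir coset through a target (S1 would force `f_t(t) = 0 ≠ 1`) — consistent.
* GENERAL FORM paragraph (separated ⇔ TPP' ∧ targets ∉ supports of `T_k^⊥ ∩ ℂ^Q`): this line is its constructive
  half — a Garnir-avoidance tree is an explicit witness that `δ_t|_Q ∈ T_k|_Q`.
Dead lines: none recorded on the item (round 1). Negatives index (`ledger negatives --problem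
MatrixMultiplication`): ExactLineDesign / ExactFrameDesign / SeparableDesignsMultiplicative / LevelTwoBeatsCubes —
none restated (no fixed level, no finite-field frame, no Kronecker flattening here).

Namespace `…Cruxes.SnLevelDesigns.GarnirAnnihilator`. Conventions as in the accepted skeletons (e.g.
`CriticalPhenomena/…/StableConeRPRigidity/Lines/cross-theorem-analyticity.lean`): each stub statement is a plain
`def … : Prop`; the REGISTERED stubs are the sorried `theorem stub_…` (statement unfolded one level); the name-keyed
aliases `Registered.stub_…` are the hypotheses of `SnLevelDesigns_of`. Vocabulary (`schenstedSet`, `bruhatLE`,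
`KTokenSeparated`) is copied VERBATIM from `Ideator3Sketch.lean` (kl-schensted-certificate) so the two lines'
statements are syntactically interchangeable.
-/

set_option linter.dupNamespace false

noncomputable section

namespace Summit.MatrixMultiplication.MatrixMultiplication.Cruxes.SnLevelDesigns.GarnirAnnihilator

open scoped BigOperators
open Literature.NumberTheory.DiophantineGeometry (numStandardTableaux)

variable {n : ℕ}

/-! ## Vocabulary (elementary; no submodules) -/

/-- The `k`-token test functional with coefficient table `c`: `g ↦ Σ_{p : [k] → [n]} c p (g ∘ p)` (verbatim the
crux's test functions; `= Disproof.tokenFn`). -/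
def tokenFn {n k : ℕ} (c : (Fin k → Fin n) → (Fin k → Fin n) → ℂ) (g : Equiv.Perm (Fin n)) : ℂ :=
  ∑ p : Fin k → Fin n, c p (⇑g ∘ p)

/-- The crux's separation clause, verbatim (first conjunct of `SnLevelDesigns` at fixed `n, k`; `= Disproof.Sep`,
`= Ideator3.KTokenSeparated`). -/
def KTokenSeparated (n k : ℕ) (X Y Z : Finset (Equiv.Perm (Fin n))) : Prop :=
  ∀ x₀ ∈ X, ∀ z₀ ∈ Z, ∃ c : (Fin k → Fin n) → (Fin k → Fin n) → ℂ,
    ∀ x ∈ X, ∀ y ∈ Y, ∀ y' ∈ Y, ∀ z ∈ Z,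
      (∑ p : Fin k → Fin n, c p (⇑(x⁻¹ * y * y'⁻¹ * z) ∘ p)) =
        if x = x₀ ∧ y = y' ∧ z = z₀ then 1 else 0

/-- `g` has an increasing subsequence of length `≥ m` (verbatim `Ideator3.HasIncSubseq`). -/
def HasIncSubseq (g : Equiv.Perm (Fin n)) (m : ℕ) : Prop :=
  ∃ s : Finset (Fin n), m ≤ s.card ∧ StrictMonoOn (⇑g) (s : Set (Fin n))

/-- The **Schensted shell** `B_k(n) = {g ∈ 𝔖ₙ : lis(g) ≥ n - k}` (verbatim `Ideator3.schenstedSet`);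
`#B_k = Σ_{μ₁ ≥ n-k} (f^μ)²` (Schensted 1961) `= dim T_k` (EFP 2011 Thm 7). -/
def schenstedSet (n k : ℕ) : Set (Equiv.Perm (Fin n)) := {g | HasIncSubseq g (n - k)}

/-- (Strong) Bruhat order on `𝔖ₙ` by the rank-matrix criterion (Björner–Brenti Thm 2.1.5; verbatim
`Ideator3.bruhatLE`, identity at the bottom): `v ≤ w` iff for all `i, j`, `#{a < i : v(a) < j} ≥ #{a < i : w(a) < j}`. -/
def bruhatLE (v w : Equiv.Perm (Fin n)) : Prop :=
  ∀ i j : ℕ,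
    (Finset.univ.filter (fun a : Fin n => (a : ℕ) < i ∧ ((w a : Fin n) : ℕ) < j)).card ≤
      (Finset.univ.filter (fun a : Fin n => (a : ℕ) < i ∧ ((v a : Fin n) : ℕ) < j)).card

/-- The POSITION WEIGHT `Φ(w) = Σ_i i · w(i)` of a permutation (LEAD RESHAPE, replaces the inversion count as the
straightening measure): sorting an inverted pair of positions strictly increases it, un-sorting strictly decreases it
(`Φ(w ∘ swap a b) - Φ(w) = (b - a)(w a - w b)`), so a block-decreasing `p` is the unique `Φ`-minimum of its
block coset and an `S`-increasing `b` is the unique `Φ`-maximum of its `T`-coset (rearrangement inequality). -/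
def posWeight (w : Equiv.Perm (Fin n)) : ℕ :=
  ∑ i : Fin n, (i : ℕ) * ((w i : Fin n) : ℕ)

/-- The Young subgroup of a block labelling `blk` (blocks = fibres of `blk`), as a finset:
`{σ | blk (σ a) = blk a for all a}`. -/
def blockStab (blk : Fin n → Fin n) : Finset (Equiv.Perm (Fin n)) :=
  Finset.univ.filter fun σ => ∀ a, blk (σ a) = blk a

/-- Number of (non-empty) blocks of the labelling `blk`; the EXCESS of the block system is `n - numBlocks blk`. -/
def numBlocks (blk : Fin n → Fin n) : ℕ := (Finset.univ.image blk).card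

/-- An **admissible Garnir system** for `p` at level `k`: excess `≥ k + 1` and `p` strictly decreasing on every
block (so that `p` is the top of its coset `p · blockStab blk`). -/
def Admissible (k : ℕ) (blk : Fin n → Fin n) (p : Equiv.Perm (Fin n)) : Prop :=
  numBlocks blk + k + 1 ≤ n ∧ ∀ a b : Fin n, blk a = blk b → a < b → p b < p a

/-- The **Garnir-avoidance set** of a target `t` at level `k`: the permutations `p` for which a straightening tree
along Garnir coset relations (the certifier's choice of block systems of excess `≥ k+1`, any shape) ends in shell
elements `≠ t` or in elements not Bruhat-above `t`. The dual functional of `t` vanishes on it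
(`tokenFn_eq_zero_of_garnirAvoid`, from S1–S4). -/
inductive GarnirAvoid (n k : ℕ) (t : Equiv.Perm (Fin n)) : Equiv.Perm (Fin n) → Prop
  | shell {p : Equiv.Perm (Fin n)} : p ∈ schenstedSet n k → p ≠ t → GarnirAvoid n k t p
  | incomparable {p : Equiv.Perm (Fin n)} : ¬ bruhatLE t p → GarnirAvoid n k t p
  | step {p : Equiv.Perm (Fin n)} (blk : Fin n → Fin n) : numBlocks blk + k + 1 ≤ n →
      (∀ σ ∈ blockStab blk, σ ≠ 1 → GarnirAvoid n k t (p * σ)) → GarnirAvoid n k t p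

/-- A **Garnir-certified** triple at level `k`: `k ≤ n`, targets in the Schensted shell, and every non-target
quadruple product Garnir-avoids every target. (TPP is implied: another target `x⁻¹z` avoids `t` only through
`shell`, i.e. `x⁻¹z ≠ t`; a product equal to `t` has no certificate, cf. `separated_of_certified`.) -/
def GarnirCertified (n k : ℕ) (X Y Z : Finset (Equiv.Perm (Fin n))) : Prop :=
  k ≤ n ∧ (∀ x ∈ X, ∀ z ∈ Z, x⁻¹ * z ∈ schenstedSet n k) ∧
    ∀ x₀ ∈ X, ∀ z₀ ∈ Z, ∀ x ∈ X, ∀ y ∈ Y, ∀ y' ∈ Y, ∀ z ∈ Z, ¬ (x = x₀ ∧ y = y' ∧ z = z₀) →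
      GarnirAvoid n k (x₀⁻¹ * z₀) (x⁻¹ * y * y'⁻¹ * z)

/-- `D_k(n) = Σ_{μ ⊢ n, μ₁ ≥ n-k} (f^μ)²` (`= dim T_k`; the right-hand side of route item `TokenWall`, verbatim
`Ideator2.levelDim` of card poly-slack-transfer). -/
def levelDim (n k : ℕ) : ℕ :=
  ∑ μ : Nat.Partition n, if n - k ≤ μ.parts.sup then numStandardTableaux μ ^ 2 else 0

/-! ## S1 — Garnir vanishing (the lever; size S–M) -/

/-- **S1 `GarnirVanishing`.** For a block labelling `blk` of excess `≥ k + 1` (`numBlocks blk + k + 1 ≤ n`), every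
token table `c` and all `a, b`: `Σ_{σ ∈ blockStab blk} sgn(σ) · tokenFn c (a σ b) = 0` — the signed indicator of
any two-sided translate of the Young-subgroup coset is orthogonal to the `k`-token space. Proof (card §(3),
triage-verified × 3): fix the tuple `p`; `b ∘ p` has `≤ k` values, the blocks have total excess `≥ k+1`, so some
block contains two positions `u ≠ v` outside `range (b ∘ p)`; `σ ↦ σ * swap u v` is a sign-reversing involution of
`blockStab blk` preserving `(a σ b) ∘ p`. Why it might fail: it does not (special cases are
`Disproof.sum_coset_sign_mul_tokenFn`, `Disproof.sum_sign_mul_tokenFn`, same proof). [cite: JamesLNM682 §7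
(Garnir relations); EllisFriedgutPilpel2011 Thm 7; Disproof.lean `sum_coset_sign_mul_tokenFn`] -/
def GarnirVanishing : Prop :=
  ∀ (n k : ℕ) (blk : Fin n → Fin n), numBlocks blk + k + 1 ≤ n →
    ∀ (c : (Fin k → Fin n) → (Fin k → Fin n) → ℂ) (a b : Equiv.Perm (Fin n)),
      (∑ σ ∈ blockStab blk, ((Equiv.Perm.sign σ : ℤ) : ℂ) * tokenFn c (a * σ * b)) = 0

/-- Registered stub S1 (statement = `GarnirVanishing`, spelled out in tree-only vocabulary so that the landed
`Theorems` helper can carry the identical name + signature). -/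
theorem stub_garnirVanishing :
    ∀ (n k : ℕ) (blk : Fin n → Fin n), (Finset.univ.image blk).card + k + 1 ≤ n →
      ∀ (c : (Fin k → Fin n) → (Fin k → Fin n) → ℂ) (a b : Equiv.Perm (Fin n)),
        (∑ σ ∈ Finset.univ.filter (fun σ : Equiv.Perm (Fin n) => ∀ x, blk (σ x) = blk x),
          ((Equiv.Perm.sign σ : ℤ) : ℂ) * ∑ p : Fin k → Fin n, c p (⇑(a * σ * b) ∘ p)) = 0 := by
  sorry

/-! ## S2 — decreasing cover (Greene–Mirsky; size M) -/

/-- **S2 `DecreasingCover`.** A permutation outside the Schensted shell (no increasing subsequence of length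
`n - k`) is strictly decreasing on the blocks of some labelling with at most `n - k - 1` blocks, i.e. it carries an
`Admissible` Garnir system. Proof: patience levels `blk a :=` (length of the longest increasing subsequence ending
at position `a`) `- 1`; equal levels form a decreasing subsequence, and the number of levels is `lis < n - k`
(Mirsky's dual of Dilworth for the 2-dimensional order `a < b ∧ p a < p b`). Vacuous for `k ≥ n`. Why it might
fail: it does not (textbook); the cost is the finitary bookkeeping of `lis` in Lean (no Mathlib API for longest
increasing subsequences). [cite: Schensted1961 (doi:10.4153/CJM-1961-015-3); Greene1974; BjornerBrenti2005 §2] -/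
def DecreasingCover : Prop :=
  ∀ (n k : ℕ) (p : Equiv.Perm (Fin n)), p ∉ schenstedSet n k → ∃ blk : Fin n → Fin n, Admissible k blk p

/-- Registered stub S2 (statement = `DecreasingCover`, spelled out in tree-only vocabulary). -/
theorem stub_decreasingCover :
    ∀ (n k : ℕ) (p : Equiv.Perm (Fin n)),
      (¬ ∃ s : Finset (Fin n), n - k ≤ s.card ∧ StrictMonoOn (⇑p) (s : Set (Fin n))) →
        ∃ blk : Fin n → Fin n, (Finset.univ.image blk).card + k + 1 ≤ n ∧
          ∀ a b : Fin n, blk a = blk b → a < b → p b < p a := by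
  sorry

/-! ## S3 — block descent (size M) -/

/-- **S3 `BlockDescent`.** If `p` is strictly decreasing on the blocks of `blk`, then every proper rearrangement
`p * σ` (`σ ∈ blockStab blk`, `σ ≠ 1`: the values of `p` permuted WITHIN blocks of positions) is Bruhat-below `p`
in the rank-matrix order and has strictly LARGER position weight `Φ` (lead reshape: `Φ` instead of the inversion
count — `p` is the `Φ`-minimum of its block coset by the rearrangement inequality / one-swap computation). Proof: for a prefix `[0,i)` and a threshold `j`, block
by block, `p` puts the LARGEST values of the block on its earliest positions, which minimises the number of values
`< j` among the first `r` positions of the block — summing over blocks gives `bruhatLE (p*σ) p`; inversions inside a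
block drop strictly where `σ` acts non-trivially and the inversions between a block and any outside position are
maximised by the decreasing arrangement (`2x + m - r - s ≤ m - |r - s|`). Why it might fail: it does not (it is
"`p` is the longest element of `p·W_J`" for a conjugated Young subgroup, checked directly on rank matrices); cost
M (finset counting). [cite: BjornerBrenti2005 Thm 2.1.5, Prop 2.4.4; Mathlib `Monovary.sum_smul_comp_perm_le_sum_smul`] -/
def BlockDescent : Prop :=
  ∀ (n : ℕ) (blk : Fin n → Fin n) (p : Equiv.Perm (Fin n)),
    (∀ a b : Fin n, blk a = blk b → a < b → p b < p a) →
    ∀ σ ∈ blockStab blk, σ ≠ 1 → bruhatLE (p * σ) p ∧ posWeight p < posWeight (p * σ)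

/-- Registered stub S3 (statement = `BlockDescent`, spelled out in tree-only vocabulary). -/
theorem stub_blockDescent :
    ∀ (n : ℕ) (blk : Fin n → Fin n) (p : Equiv.Perm (Fin n)),
      (∀ a b : Fin n, blk a = blk b → a < b → p b < p a) →
        ∀ σ ∈ Finset.univ.filter (fun σ : Equiv.Perm (Fin n) => ∀ x, blk (σ x) = blk x), σ ≠ 1 →
          (∀ i j : ℕ,
              (Finset.univ.filter (fun a : Fin n => (a : ℕ) < i ∧ ((p a : Fin n) : ℕ) < j)).card ≤
                (Finset.univ.filter (fun a : Fin n => (a : ℕ) < i ∧ (((p * σ) a : Fin n) : ℕ) < j)).card) ∧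
            (∑ i : Fin n, (i : ℕ) * ((p i : Fin n) : ℕ)) < ∑ i : Fin n, (i : ℕ) * (((p * σ) i : Fin n) : ℕ) := by
  sorry

/-! ## S4 — shell interpolation (RSS 2009 Thm 2 at `(n-k,1^k)`; size L) -/

/-- **S4 `ShellInterpolation`** (`= Ideator3.SchenstedInterpolates` in token-table form). For `k ≤ n` every
function on the Schensted shell is the restriction of a `k`-token function; equivalently the shell is linearly
independent in `A_k = ℂ𝔖ₙ/T_k^⊥`, equivalently NO non-zero element of the annihilator `T_k^⊥` is supported
inside the shell. With the spanning half (Garnir straightening, S1–S3, proved below) it is the COUNT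
`#B_k(n) = Σ_{μ₁ ≥ n-k}(f^μ)² = dim T_k` (Schensted's theorem via RSK + `EllisFriedgutPilpel2011_thm7_holds` and
Specht dimensions `finrank_spechtIdeal_holds`) — size L because RSK is not in Mathlib; alternatively vendor
RSS 2009 Thm 2 (`arXiv:0902.2842`, p. 3, read by triage r1-2/r1-3) as a Literature fact. Guard `k ≤ n` needed
(triage r1-3 `N0self.lean`: false at `n = 0 < k`). Numerically certain: exact rank checks at all `(n,k)` with
`n ≤ 7` and `(8,2)` by three independent codes (kit j008490, j010256, j010266/j010362). Why it might fail: it does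
not over `ℂ` (published theorem); the risk is size. [cite: RaghavanSamuelSubrahmanyam2009 Thm 2 (arXiv:0902.2842);
Schensted1961; EllisFriedgutPilpel2011 Thm 7] -/
def ShellInterpolation : Prop :=
  ∀ (n k : ℕ), k ≤ n → ∀ v : Equiv.Perm (Fin n) → ℂ,
    ∃ c : (Fin k → Fin n) → (Fin k → Fin n) → ℂ, ∀ g ∈ schenstedSet n k, tokenFn c g = v g

/-- Registered stub S4 (statement = `ShellInterpolation`, spelled out in tree-only vocabulary). -/
theorem stub_shellInterpolation :
    ∀ (n k : ℕ), k ≤ n → ∀ v : Equiv.Perm (Fin n) → ℂ,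
      ∃ c : (Fin k → Fin n) → (Fin k → Fin n) → ℂ,
        ∀ g : Equiv.Perm (Fin n),
          (∃ s : Finset (Fin n), n - k ≤ s.card ∧ StrictMonoOn (⇑g) (s : Set (Fin n))) →
            (∑ p : Fin k → Fin n, c p (⇑g ∘ p)) = v g := by
  sorry

/-! ## S5 — ε-glue: sub-exponential slack is free (Vershik–Kerov; size M) — PLANNER GEN-2 VARIANT -/

/-- The **sub-exponential wall form** of a family of level-`k` triples with property `P` (PLANNER GEN-2 VARIANT,
shared by S5 and S6): for every `δ > 0` and every `k₀` there is a member with `k ≥ k₀`, `3k ≤ n` (the regime of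
S5h (b)), property `P`, and `D_k(n)^{3/2} ≤ e^{δ√k} · |X||Y||Z|` — i.e. along the family the volume is
`D_k^{3/2} e^{-o(√k)}`.  By the power-mean inequality this is, up to the constant in front of `√k` and the regime
guard, what the crux forces of its own witnesses as `ε → 0`: a separated triple at exponent `2+ε` has
`V^{(2+ε)/3} > Σ_{μ₁≥n-k}(f^μ)^{2+ε} ≥ N_k^{-ε/2} D_k^{1+ε/2}`, i.e. `V > D_k^{3/2} N_k^{-3ε/(2(2+ε))} ≥
D_k^{3/2} e^{-1.93ε√k - O(ε log k)}` (`N_k = #{μ : μ₁ ≥ n-k} ≤ (k+1)p(k)`), so polynomial slack `k^{-C}` is NOT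
implied by the crux while `e^{-o(√k)}` slack is. The gen-1 / lead form (`∃ C`, `k^C`, `k³ ≤ n`) implies this one
(`k^C ≤ e^{δ√k}` and `k³ ≥ 3k` for `k ≥ k(C,δ)`). -/
def NearWall (P : (n : ℕ) → ℕ → Finset (Equiv.Perm (Fin n)) → Finset (Equiv.Perm (Fin n)) →
    Finset (Equiv.Perm (Fin n)) → Prop) : Prop :=
  ∀ δ : ℝ, 0 < δ → ∀ k₀ : ℕ, ∃ k : ℕ, k₀ ≤ k ∧ ∃ (n : ℕ) (X Y Z : Finset (Equiv.Perm (Fin n))),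
    3 * k ≤ n ∧ P n k X Y Z ∧
      ((levelDim n k : ℕ) : ℝ) ^ ((3 : ℝ) / 2) ≤
        Real.exp (δ * Real.sqrt (k : ℝ)) * ((X.card * Y.card * Z.card : ℕ) : ℝ)

/-- **S5 `EpsilonGlue`** — PLANNER GEN-2 VARIANT (sub-exponential slack; the lead's registered form has the
family hypothesis `∃ C … k³ ≤ n ∧ … ≤ k^C · V` instead of `NearWall P`). For ANY property `P` of level-`k` triples:
`NearWall P →` for every `ε > 0` some member satisfies the crux's budget inequality
`Σ_{μ₁ ≥ n-k} (f^μ)^{2+ε} < (|X||Y||Z|)^{(2+ε)/3}`. Proof = the lead's S5h + S5g analysis with one constant changed: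
`Σ f^{2+ε} ≤ θ^ε D_k^{1+ε/2}` with `θ := F/√D_k ≤ e^{1-(c₂/(2√2))√k}` for `3k ≤ n`, `k ≥ k₁` (S5h (a),(b) + VK);
given `ε` choose `δ := c₂ε/(4(2+ε))` in `NearWall`, so `V^{(2+ε)/3} ≥ D_k^{1+ε/2} e^{-(c₂ε/12)√k}`, and
`θ^ε < e^{-(c₂ε/12)√k}` as soon as `1 - 0.353c₂√k < -0.084c₂√k`, i.e. `k ≥ 1100`; take `k₀ := max(k₁, 1100)`.
Numerics (planner g2, exact hook lengths, `Cruxes/…/gen2_numerics.md` on the item): `log(√D_k/F)/√k ∈ [0.21,0.43]`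
for `6 ≤ k ≤ 28`, `k ≤ n ≤ k³`. Why it might fail: it does not. [cite: VershikKerov1985 (via PakPanovaYeliussizov2019
arXiv:1804.04693 §2.3); `numStandardTableaux_mul_prod_hookLength_holds`; `sum_sq_numStandardTableaux`] -/
def EpsilonGlue : Prop :=
  ∀ P : (n : ℕ) → ℕ → Finset (Equiv.Perm (Fin n)) → Finset (Equiv.Perm (Fin n)) →
      Finset (Equiv.Perm (Fin n)) → Prop,
    NearWall P →
    ∀ ε : ℝ, 0 < ε → ∃ (n k : ℕ) (X Y Z : Finset (Equiv.Perm (Fin n))), P n k X Y Z ∧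
      (∑ μ : Nat.Partition n,
          if n - k ≤ μ.parts.sup then (numStandardTableaux μ : ℝ) ^ (2 + ε) else 0) <
        ((X.card * Y.card * Z.card : ℕ) : ℝ) ^ ((2 + ε) / 3)


/-- **S5h `FirstRowHooks`** (LEAD RESHAPE of S5, first half; size L, provable now from the tree's hook length
formula `numStandardTableaux_mul_prod_hookLength_holds`): FIRST-ROW PEELING for the shapes the budget sums over.
Write a shape `μ ⊢ n` with largest part `m = μ.parts.sup` as `μ = (m, ν)`, `ν ⊢ j := n - m`; the hooks of `μ` in
rows `≥ 1` are the hooks of `ν`, and the hook of the box `(0, c)` is `(m - c) + ν'_c ≥ m - c`. Hence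
(a) `f^μ = n!/∏h ≤ n!/(m! · j!/f^ν) = C(n,j) f^ν ≤ C(n,j) · D(j)` (`D(j) = maxCharDegree 𝔖_j`,
`numStandardTableaux_le_maxCharDegree`); and (b) for `3k ≤ n` and every `ν ⊢ k` the shape `(n-k, ν)` has
`∏_{c} h(0,c) = (n-k)! ∏_{c<ν₁}(1 + ν'_c/(n-k-c)) ≤ (n-k)! e^{k/(n-2k+1)} ≤ e·(n-k)!`, so
`f^{(n-k,ν)} ≥ C(n,k) f^ν / e`, and summing the squares over `ν ⊢ k` (`Σ (f^ν)² = k!`,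
`sum_sq_numStandardTableaux`; the shapes `(n-k,ν)` are pairwise distinct level-`k` shapes)
`levelDim n k ≥ e^{-2} C(n,k)² k!`. [cite: FrameRobinsonThrallCJM1954 Thm 1; FultonYoungTableaux1997 §7.2] -/
def FirstRowHooks : Prop :=
  (∀ (n : ℕ) (μ : Nat.Partition n),
      numStandardTableaux μ ≤ n.choose (n - μ.parts.sup) *
        Literature.RepresentationTheory.FiniteGroups.maxCharDegree (Equiv.Perm (Fin (n - μ.parts.sup)))) ∧
  (∀ (n k : ℕ), 3 * k ≤ n →
      Real.exp (-2) * ((n.choose k : ℝ) ^ 2 * (k.factorial : ℝ)) ≤ ((levelDim n k : ℕ) : ℝ))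

/-- Registered stub S5h (statement = `FirstRowHooks`, spelled out in tree-only vocabulary). -/
theorem stub_firstRowHooks :
    (∀ (n : ℕ) (μ : Nat.Partition n),
        Literature.NumberTheory.DiophantineGeometry.numStandardTableaux μ ≤ n.choose (n - μ.parts.sup) *
          Literature.RepresentationTheory.FiniteGroups.maxCharDegree (Equiv.Perm (Fin (n - μ.parts.sup)))) ∧
      (∀ (n k : ℕ), 3 * k ≤ n →
        Real.exp (-2) * ((n.choose k : ℝ) ^ 2 * (k.factorial : ℝ)) ≤
          ((∑ μ : Nat.Partition n, if n - k ≤ μ.parts.sup then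
              Literature.NumberTheory.DiophantineGeometry.numStandardTableaux μ ^ 2 else 0 : ℕ) : ℝ)) := by
  sorry

/-- **S5g `HookGlue`** — PLANNER GEN-2 VARIANT: `FirstRowHooks → EpsilonGlue` with `EpsilonGlue` in the
sub-exponential (`NearWall`) form (size M, real analysis only). Given `NearWall P` and `ε > 0`: `budget =
Σ_{μ₁≥n-k}(f^μ)^{2+ε} ≤ F^ε · D_k` with `F = max_{μ₁ ≥ n-k} f^μ`; by S5h (a), for `j := n - μ₁ ≤ k`,
`f^μ ≤ C(n,j) D(j)`, and by S5h (b) `√D_k ≥ e^{-1} C(n,k) √(k!)` (`3k ≤ n`); `C(n,j)/C(n,k) ≤ (k/(n-k+1))^{k-j} ≤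
2^{-(k-j)}`; for `j ≤ k/2` this is `≤ 2^{-k/2}`, for `j > k/2` use `D(j) ≤ √(j!) e^{-(c₂/2)√j}` (tree theorem
`VershikKerov1985_maxCharDegree_holds` at `ε := vkUpperConst/2`, `j ≥ n₀`) — so `θ := F/√D_k ≤ e^{1-c'√k}`,
`c' = vkUpperConst/(2√2)`, for `k ≥ k₁`; instantiate `NearWall` at `δ := vkUpperConst·ε/(4(2+ε))` and
`k₀ := max(k₁, 1100)`: then `budget ≤ θ^ε D_k^{1+ε/2} < e^{-δ(2+ε)√k/3} D_k^{1+ε/2} ≤ V^{(2+ε)/3}` (`D_k ≥ 1`,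
`V ≥ 1`). A proof of this variant also proves the lead's registered `stub_hookGlue` (its `k^C`/`k³` hypothesis
implies `NearWall P`). -/
def HookGlue : Prop :=
  FirstRowHooks → EpsilonGlue

/-- Stub S5g, PLANNER GEN-2 VARIANT (statement = `HookGlue`, spelled out in tree-only vocabulary). -/
theorem stub_hookGlue :
    ((∀ (n : ℕ) (μ : Nat.Partition n),
        Literature.NumberTheory.DiophantineGeometry.numStandardTableaux μ ≤ n.choose (n - μ.parts.sup) *
          Literature.RepresentationTheory.FiniteGroups.maxCharDegree (Equiv.Perm (Fin (n - μ.parts.sup)))) ∧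
      (∀ (n k : ℕ), 3 * k ≤ n →
        Real.exp (-2) * ((n.choose k : ℝ) ^ 2 * (k.factorial : ℝ)) ≤
          ((∑ μ : Nat.Partition n, if n - k ≤ μ.parts.sup then
              Literature.NumberTheory.DiophantineGeometry.numStandardTableaux μ ^ 2 else 0 : ℕ) : ℝ))) →
      ∀ P : (n : ℕ) → ℕ → Finset (Equiv.Perm (Fin n)) → Finset (Equiv.Perm (Fin n)) →
          Finset (Equiv.Perm (Fin n)) → Prop,
        (∀ δ : ℝ, 0 < δ → ∀ k₀ : ℕ, ∃ k : ℕ, k₀ ≤ k ∧ ∃ (n : ℕ) (X Y Z : Finset (Equiv.Perm (Fin n))),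
            3 * k ≤ n ∧ P n k X Y Z ∧
              ((∑ μ : Nat.Partition n, if n - k ≤ μ.parts.sup then
                  Literature.NumberTheory.DiophantineGeometry.numStandardTableaux μ ^ 2 else 0 : ℕ) : ℝ) ^ ((3 : ℝ) / 2) ≤
                Real.exp (δ * Real.sqrt (k : ℝ)) * ((X.card * Y.card * Z.card : ℕ) : ℝ)) →
        ∀ ε : ℝ, 0 < ε → ∃ (n k : ℕ) (X Y Z : Finset (Equiv.Perm (Fin n))), P n k X Y Z ∧
          (∑ μ : Nat.Partition n, if n - k ≤ μ.parts.sup then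
              (Literature.NumberTheory.DiophantineGeometry.numStandardTableaux μ : ℝ) ^ (2 + ε) else 0) <
            ((X.card * Y.card * Z.card : ℕ) : ℝ) ^ ((2 + ε) / 3) := by
  sorry

/-! ## S6 — Garnir-certified designs sub-exponentially near the wall (the closer; size XL, open) — PLANNER GEN-2 VARIANT -/

/-- **S6 `GarnirDesigns`** — PLANNER GEN-2 VARIANT (the lead's registered form: `∃ C ∀ k₀ ∃ k ≥ k₀ ∃ n ≥ k³ …
≤ k^C · V`). `NearWall GarnirCertified`: for every `δ > 0` and arbitrarily large `k` some `n ≥ 3k` carries a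
GARNIR-CERTIFIED triple (`GarnirCertified`: `k ≤ n`, targets in the Schensted shell, every non-target quadruple
product in the Garnir-avoidance set of every target) with `D_k(n)^{3/2} ≤ e^{δ√k} · |X||Y||Z|`.
WHY THIS FORM: no linear algebra in dimension `D_k`, no `ε`, and exactly the slack the crux itself must exhibit as
`ε → 0` is granted (`e^{o(√k)}` free by S5, nothing more demanded by the power mean — see `NearWall`), so the budget
clause is a reformulation, not a strengthening, of the crux's; the registered `k^C` form implies it and could be
FALSE with the crux TRUE (a family with `V ≈ D_k^{3/2} e^{-√k/log k}` witnesses the crux and refutes the `k^C`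
form). Everything else — certificate, kill-test filters, why it might fail — as in the lead's docstring; in addition
near the wall all three pair products are `≥ D_k e^{-2δ√k}` (dimension walls), so the targets `X⁻¹Z` must fill an
`e^{-o(√k)}` fraction of the shell `B_k` up to the two-sided translations `Q ↦ aQb` preserving separation.
[cite: BlasiakChurchCohnGrochowUmans2017 §5 (open); Disproof.lean `exists_coset_point_not_mem_quot`;
Negative/NeumannLevelK.lean `volume_le_of_cubic_budget`] -/
def GarnirDesigns : Prop :=
  NearWall GarnirCertified

/-- Stub S6, PLANNER GEN-2 VARIANT (statement = `GarnirDesigns`, `NearWall` unfolded). -/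
theorem stub_garnirDesigns :
    ∀ δ : ℝ, 0 < δ → ∀ k₀ : ℕ, ∃ k : ℕ, k₀ ≤ k ∧ ∃ (n : ℕ) (X Y Z : Finset (Equiv.Perm (Fin n))),
      3 * k ≤ n ∧ GarnirCertified n k X Y Z ∧
        ((levelDim n k : ℕ) : ℝ) ^ ((3 : ℝ) / 2) ≤
          Real.exp (δ * Real.sqrt (k : ℝ)) * ((X.card * Y.card * Z.card : ℕ) : ℝ) := by
  sorry


/-! ### Registered-stub aliases
`Registered.stub_X` is stub `X`'s statement under the registered stub's short name, so that the native skeleton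
audit (`#h21_check_skeleton … stub_…`, run by `ledger skeleton check`) accepts the hypotheses of
`SnLevelDesigns_of` as the registered obligations (hypothesis heads are matched by name). -/
namespace Registered

/-- Statement of registered stub S1. -/
abbrev stub_garnirVanishing : Prop := GarnirVanishing
/-- Statement of registered stub S2. -/
abbrev stub_decreasingCover : Prop := DecreasingCover
/-- Statement of registered stub S3. -/
abbrev stub_blockDescent : Prop := BlockDescent
/-- Statement of registered stub S4. -/
abbrev stub_shellInterpolation : Prop := ShellInterpolation
/-- Statement of registered stub S5h. -/
abbrev stub_firstRowHooks : Prop := FirstRowHooks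
/-- Statement of registered stub S5g. -/
abbrev stub_hookGlue : Prop := HookGlue
/-- Statement of registered stub S6. -/
abbrev stub_garnirDesigns : Prop := GarnirDesigns

end Registered

/-! ## Elementary facts about the vocabulary (proved) -/

theorem mem_blockStab {blk : Fin n → Fin n} {σ : Equiv.Perm (Fin n)} :
    σ ∈ blockStab blk ↔ ∀ a, blk (σ a) = blk a := by
  simp [blockStab]

theorem one_mem_blockStab (blk : Fin n → Fin n) : (1 : Equiv.Perm (Fin n)) ∈ blockStab blk := by
  simp [blockStab]

theorem bruhatLE_refl (w : Equiv.Perm (Fin n)) : bruhatLE w w := fun _ _ => le_rfl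

theorem bruhatLE_trans {u v w : Equiv.Perm (Fin n)} (h₁ : bruhatLE u v) (h₂ : bruhatLE v w) :
    bruhatLE u w := fun i j => (h₂ i j).trans (h₁ i j)

/-- Crude bound `Φ(w) ≤ n·n·n` (each of the `n` terms is `< n·n`), used to run the straightening induction on
the co-weight `n³ - Φ`. -/
theorem posWeight_le (w : Equiv.Perm (Fin n)) : posWeight w ≤ n * (n * n) := by
  unfold posWeight
  calc ∑ i : Fin n, (i : ℕ) * ((w i : Fin n) : ℕ) ≤ ∑ _i : Fin n, n * n :=
        Finset.sum_le_sum fun i _ => Nat.mul_le_mul (le_of_lt i.isLt) (le_of_lt (w i).isLt)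
    _ = n * (n * n) := by simp [Finset.sum_const, Finset.card_univ, Fintype.card_fin]

/-! ## Garnir straightening, annihilator side (proved from the stubs) -/

/-- One Garnir step (from S1, right-coset form `a = p`, `b = 1`): if the token function `f_c` vanishes on every
PROPER rearrangement `p σ` of `p` under a block labelling of excess `≥ k+1`, it vanishes at `p`. -/
theorem tokenFn_eq_zero_of_children (hV : GarnirVanishing) {n k : ℕ} {blk : Fin n → Fin n}
    (hexc : numBlocks blk + k + 1 ≤ n) (c : (Fin k → Fin n) → (Fin k → Fin n) → ℂ)
    (p : Equiv.Perm (Fin n)) (hch : ∀ σ ∈ blockStab blk, σ ≠ 1 → tokenFn c (p * σ) = 0) :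
    tokenFn c p = 0 := by
  classical
  have hsum := hV n k blk hexc c p 1
  rw [Finset.sum_eq_single_of_mem (1 : Equiv.Perm (Fin n)) (one_mem_blockStab blk)] at hsum
  · simpa using hsum
  · intro σ hσ hne
    rw [mul_one, hch σ hσ hne, mul_zero]

/-- **Garnir straightening ⇒ Bruhat shadow** (from S1 + S2 + S3, induction on inversions): a token function that
is `δ_t` on the Schensted shell vanishes at every `p` that is not Bruhat-above `t` — the annihilator-side,
Kazhdan–Lusztig-free proof of `Ideator3.ShadowStraightening`'s consequence for dual functionals. -/
theorem tokenFn_eq_zero_of_not_bruhatLE (hV : GarnirVanishing) (hC : DecreasingCover) (hD : BlockDescent)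
    {n k : ℕ} {t : Equiv.Perm (Fin n)} {c : (Fin k → Fin n) → (Fin k → Fin n) → ℂ}
    (hc : ∀ g ∈ schenstedSet n k, tokenFn c g = if g = t then 1 else 0) :
    ∀ p : Equiv.Perm (Fin n), ¬ bruhatLE t p → tokenFn c p = 0 := by
  classical
  -- strong induction on the co-weight `n³ - Φ(p)` (each Garnir child has strictly larger `Φ`)
  suffices h : ∀ m : ℕ, ∀ p : Equiv.Perm (Fin n),
      n * (n * n) - posWeight p < m → ¬ bruhatLE t p → tokenFn c p = 0 by
    exact fun p hp => h (n * (n * n) - posWeight p + 1) p (Nat.lt_succ_self _) hp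
  intro m
  induction m with
  | zero => intro p hp; exact absurd hp (Nat.not_lt_zero _)
  | succ m ih =>
    intro p hp hnot
    by_cases hpB : p ∈ schenstedSet n k
    · have hpt : p ≠ t := by
        rintro rfl
        exact hnot (bruhatLE_refl p)
      rw [hc p hpB, if_neg hpt]
    · obtain ⟨blk, hexc, hdec⟩ := hC n k p hpB
      refine tokenFn_eq_zero_of_children hV hexc c p fun σ hσ hσ1 => ?_
      obtain ⟨hle, hlt⟩ := hD n blk p hdec σ hσ hσ1
      have hbd := posWeight_le (p * σ)
      refine ih (p * σ) (by omega) fun htle => ?_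
      exact hnot (bruhatLE_trans htle hle)

/-- **The dual functional of a target vanishes on its Garnir-avoidance set** (from S1–S3 and the interpolation
property of `c`): induction over the avoidance tree. -/
theorem tokenFn_eq_zero_of_garnirAvoid (hV : GarnirVanishing) (hC : DecreasingCover) (hD : BlockDescent)
    {n k : ℕ} {t : Equiv.Perm (Fin n)} {c : (Fin k → Fin n) → (Fin k → Fin n) → ℂ}
    (hc : ∀ g ∈ schenstedSet n k, tokenFn c g = if g = t then 1 else 0)
    {p : Equiv.Perm (Fin n)} (hp : GarnirAvoid n k t p) : tokenFn c p = 0 := by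
  induction hp with
  | @shell p hB hne => rw [hc p hB, if_neg hne]
  | @incomparable p hnot => exact tokenFn_eq_zero_of_not_bruhatLE hV hC hD hc p hnot
  | @step p blk hexc _ ih => exact tokenFn_eq_zero_of_children hV hexc c p fun σ hσ h1 => ih σ hσ h1

/-- **Certificate theorem** (S1–S4 ⇒ `GarnirCertified → KTokenSeparated`): the dual functional `f_t` of the
target `t = x₀⁻¹z₀` (S4, `δ_t` on the shell) is the separator — it is `1` at the target quadruples and `0` at every
non-target quadruple product (all of which Garnir-avoid `t`). No separate TPP hypothesis is needed: the value is
assigned per quadruple, and a non-target quadruple producing `t` itself would need a certificate forcing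
`f_t(t) = 0`, which `GarnirCertified` therefore cannot contain. -/
theorem separated_of_certified (hV : GarnirVanishing) (hC : DecreasingCover) (hD : BlockDescent)
    (hI : ShellInterpolation) {n k : ℕ} {X Y Z : Finset (Equiv.Perm (Fin n))}
    (h : GarnirCertified n k X Y Z) : KTokenSeparated n k X Y Z := by
  classical
  obtain ⟨hkn, hT, hA⟩ := h
  intro x₀ hx₀ z₀ hz₀
  obtain ⟨c, hc⟩ := hI n k hkn (fun g => if g = x₀⁻¹ * z₀ then 1 else 0)
  refine ⟨c, fun x hx y hy y' hy' z hz => ?_⟩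
  show tokenFn c (x⁻¹ * y * y'⁻¹ * z) = _
  by_cases htarget : x = x₀ ∧ y = y' ∧ z = z₀
  · obtain ⟨rfl, rfl, rfl⟩ := htarget
    rw [if_pos ⟨rfl, rfl, rfl⟩]
    have hprod : x⁻¹ * y * y⁻¹ * z = x⁻¹ * z := by group
    rw [hprod, hc _ (hT x hx z hz), if_pos rfl]
  · rw [if_neg htarget]
    exact tokenFn_eq_zero_of_garnirAvoid hV hC hD hc (hA x₀ hx₀ z₀ hz₀ x hx y hy y' hy' z hz htarget)

/-- **The KL line's certificate is the depth-0 case.** The hypotheses of `Ideator3.ShadowCertificate` (card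
kl-schensted-certificate ≈ lis-bruhat-shield: targets in the shell; every non-target product differs from the target
and is in the shell or not Bruhat-above the target) give `GarnirCertified` using only the constructors
`shell`/`incomparable` — so S6 is implied by (the wall form of) that line's `ShadowTPP`, never harder. -/
theorem garnirCertified_of_shadow {n k : ℕ} (hkn : k ≤ n) {X Y Z : Finset (Equiv.Perm (Fin n))}
    (hT : ∀ x ∈ X, ∀ z ∈ Z, x⁻¹ * z ∈ schenstedSet n k)
    (hS : ∀ x₀ ∈ X, ∀ z₀ ∈ Z, ∀ x ∈ X, ∀ y ∈ Y, ∀ y' ∈ Y, ∀ z ∈ Z, ¬ (x = x₀ ∧ y = y' ∧ z = z₀) →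
        x⁻¹ * y * y'⁻¹ * z ≠ x₀⁻¹ * z₀ ∧
        (x⁻¹ * y * y'⁻¹ * z ∈ schenstedSet n k ∨ ¬ bruhatLE (x₀⁻¹ * z₀) (x⁻¹ * y * y'⁻¹ * z))) :
    GarnirCertified n k X Y Z :=
  ⟨hkn, hT, fun x₀ hx₀ z₀ hz₀ x hx y hy y' hy' z hz hne =>
    (hS x₀ hx₀ z₀ hz₀ x hx y hy y' hy' z hz hne).elim fun hne' h =>
      h.elim (fun hB => GarnirAvoid.shell hB hne') (fun hnot => GarnirAvoid.incomparable hnot)⟩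

/-! ## The card's kill-test (necessary direction; proved from S1 alone) -/

/-- **Kill-test** (card §(2), design-side form of the Disproof's coset obstruction, all block shapes): if the middle
set contains a full coset `y₁ · blockStab blk` of a Young subgroup of excess `≥ k+1` (e.g. `Sym` of `k+2` points, or
`k+1` disjoint transpositions) then NO target is separated: the quadruples `(x₀, y₁σ, y₁, z₀)` produce the two-sided
Garnir coset `(x₀⁻¹y₁)·S_B·(y₁⁻¹z₀)` through the target, on which every token function has signed sum `0` (S1)
while the required values have signed sum `1`. -/
theorem not_separated_of_coset_subset (hV : GarnirVanishing) {n k : ℕ} {blk : Fin n → Fin n}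
    (hexc : numBlocks blk + k + 1 ≤ n) {X Y Z : Finset (Equiv.Perm (Fin n))} {y₁ : Equiv.Perm (Fin n)}
    (hy₁ : y₁ ∈ Y) (hcos : ∀ σ ∈ blockStab blk, y₁ * σ ∈ Y) (hX : X.Nonempty) (hZ : Z.Nonempty) :
    ¬ KTokenSeparated n k X Y Z := by
  classical
  obtain ⟨x₀, hx₀⟩ := hX
  obtain ⟨z₀, hz₀⟩ := hZ
  intro hsep
  obtain ⟨c, hc⟩ := hsep x₀ hx₀ z₀ hz₀
  have hval : ∀ σ ∈ blockStab blk,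
      ((Equiv.Perm.sign σ : ℤ) : ℂ) * tokenFn c (x₀⁻¹ * y₁ * σ * (y₁⁻¹ * z₀)) =
        if σ = 1 then 1 else 0 := by
    intro σ hσ
    have h := hc x₀ hx₀ (y₁ * σ) (hcos σ hσ) y₁ hy₁ z₀ hz₀
    have hrw : x₀⁻¹ * (y₁ * σ) * y₁⁻¹ * z₀ = x₀⁻¹ * y₁ * σ * (y₁⁻¹ * z₀) := by group
    rw [hrw] at h
    change tokenFn c (x₀⁻¹ * y₁ * σ * (y₁⁻¹ * z₀)) = _ at h
    rw [h]
    by_cases h1 : σ = 1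
    · subst h1
      simp
    · have hne : ¬ (x₀ = x₀ ∧ y₁ * σ = y₁ ∧ z₀ = z₀) := by
        rintro ⟨-, h2, -⟩
        apply h1
        have h3 : y₁ * σ = y₁ * 1 := by rw [mul_one]; exact h2
        exact mul_left_cancel h3
      rw [if_neg hne, if_neg h1, mul_zero]
  have hsum := hV n k blk hexc c (x₀⁻¹ * y₁) (y₁⁻¹ * z₀)
  rw [Finset.sum_congr rfl hval, Finset.sum_ite_eq' (blockStab blk) (1 : Equiv.Perm (Fin n))
    (fun _ => (1 : ℂ)), if_pos (one_mem_blockStab blk)] at hsum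
  exact one_ne_zero hsum

/-! ## The composition (proved): S1 → S2 → S3 → S4 → S5h → S5g → S6 → crux, BY NAME -/

/-- **The skeleton closes the crux modulo the registered stubs.** S5 (= S5g fed with S5h) at `P := GarnirCertified`, fed with the
family S6, yields for the given `ε` a certified `(n, k, X, Y, Z)` with the budget inequality; S1–S4 turn the
certificate into the crux's separation clause (`separated_of_certified`; `KTokenSeparated` is that clause
definitionally). -/
theorem SnLevelDesigns_of (h₁ : Registered.stub_garnirVanishing) (h₂ : Registered.stub_decreasingCover)
    (h₃ : Registered.stub_blockDescent) (h₄ : Registered.stub_shellInterpolation)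
    (h₅ : Registered.stub_firstRowHooks) (h₅' : Registered.stub_hookGlue)
    (h₆ : Registered.stub_garnirDesigns) :
    Summit.MatrixMultiplication.MatrixMultiplication.Theses.LevelGradedCohnUmans.SnLevelDesigns := by
  intro ε hε
  obtain ⟨n, k, X, Y, Z, hcert, hlt⟩ := h₅' h₅ GarnirCertified h₆ ε hε
  exact ⟨n, k, X, Y, Z, separated_of_certified h₁ h₂ h₃ h₄ hcert, hlt⟩

/-- How the closed proof is obtained once the six stubs land (an `example`, so that `SnLevelDesigns_of` is the only
theorem of this file concluding the crux). -/
example : Summit.MatrixMultiplication.MatrixMultiplication.Theses.LevelGradedCohnUmans.SnLevelDesigns :=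
  SnLevelDesigns_of stub_garnirVanishing stub_decreasingCover stub_blockDescent stub_shellInterpolation
    stub_firstRowHooks stub_hookGlue stub_garnirDesigns

end Summit.MatrixMultiplication.MatrixMultiplication.Cruxes.SnLevelDesigns.GarnirAnnihilator

end
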